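import Summits.HodgeConjecture.CorCM.GaloisIndexTwoTimesTwo
import Summits.HodgeConjecture.CorCM.GaloisIndexTwoTimesCyclicAllDegrees
import Summits.HodgeConjecture.CorCM.GaloisCyclicSemidirectEightTwoSheet
import HarnessLib

/-!
# Product forms of the two index-two theorems, and `(C_p ⋊ C₈) × C₂` is BAD for every odd prime `p`

COR-CM (cell `pub-hodgecm2`), binder seat b04 (gen 30), count-neutral own lane «Galois-CM-type classification» (which Galois CM
fields `(G, c)` have ALL primitive CM types nondegenerate = GOOD, vs. a primitive degenerate type = BAD).  KERNEL ONLY: theorems;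
no definition, no named fact, no `sorry`.  `HC_CM` is neither used nor claimed.

§1 PRODUCT FORMS.  The theorems `exists_simple_degenerate_of_index_two_times_two` (`CorCM/GaloisIndexTwoTimesTwo`: `× C₂`,
any `q`) and `exists_simple_degenerate_of_index_two_times_cyclic` (`CorCM/GaloisIndexTwoTimesCyclicAllDegrees`: `× C_n`, `n ≥ 3`,
easy side) take index-two data for the WHOLE group `G₀ ⊇ i(A₀ × C)`.  Here are the forms one actually uses: index-two data
`(i₀ : A₀ ↪ Γ₀, x₀, θ₀, q₀, c)` for `Γ₀` ALONE and `Gal(K/ℚ) ≅ Γ₀ × C` with complex conjugation `(i₀ c, 1)`: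
* `exists_simple_degenerate_prod_two`: `Γ₀ × C₂` is BAD as soon as `|A₀| > 4` and some `u ≠ 1` of `A₀` has `c ∉ ⟨u⟩`
  (dimension `|Γ₀|`);
* `exists_simple_degenerate_prod_cyclic`: `Γ₀ × C_n` (`n ≥ 3`) is BAD as soon as `θ₀ ≠ id` and `c ∉ ⟨q₀⟩` (dimension `n|Γ₀|/2`).

§2 **`(C_p ⋊ C₈) × C₂` IS BAD FOR EVERY ODD PRIME `p`** (`exists_simple_degenerate_cyclicSemidirectEight_times_two`; `φ(1)` =
inversion, complex conjugation `(y⁴, 1)`): `A₀ = ⟨y²⟩ × C_p ≅ ℤ/4 × ℤ/p` (the index-two data of gen 28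
`CorCM/GaloisCyclicSemidirectEightDegenerate`, hard side `c = y⁴ ∈ ⟨y²⟩`), `u ∈ C_p`.  So the real quadratic factor DESTROYS the
GOOD family `C_p ⋊ C₈`, `p ≡ 5 (mod 8)` (gen 25 `CorCM/GaloisCyclicSemidirectEightFiveModEight`: all primitive types
nondegenerate): `K = K₀ · ℚ(√d)` with `Gal(K₀/ℚ) ≅ C_p ⋊ C₈` always carries a simple degenerate CM `8p`-fold — no arithmetic of
`p` enters.  (The other two central involutions `(1, t)`, `(y⁴, t)` are complemented: `⟨c⟩ × (C_p ⋊ C₈)` is BAD by gen 19's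
imaginary-quadratic capstone.)

## References

* [Kubota1965] T. Kubota, *On the field extension by complex multiplication*, Trans. AMS 118 (1965), §2, §4 Lemma 2.
* [Shimura1998] G. Shimura, *Abelian Varieties with Complex Multiplication and Modular Functions*, §6.2 Thm. 3, §8.2 Prop. 26.
* [Gordon1999HodgeAVSurvey] B. B. Gordon, *A survey of the Hodge conjecture for abelian varieties*, Thm. 6.4, §9.3.
-/

noncomputable section

open CategoryTheory CategoryTheory.Limits NumberField
open scoped BigOperators

namespace Summit.HodgeConjecture.CorCM.SplitInvolution

open Literature.NumberTheory.ComplexMultiplication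
open Literature.AlgebraicGeometry.Motives (AbelianVariety CMType)
open Literature.AlgebraicGeometry.HodgeTheory
open Literature.AlgebraicGeometry.ComplexMultiplication (IsCMTypeRealisation)
open Literature.AlgebraicGeometry.Pohlmann1968
open Literature.Barriers.HodgeConjecture (divisorClassesSpan)

/-! ## §1 Product forms -/

section Product

variable {Γ₀ : Type*} [Group Γ₀] [Fintype Γ₀] [DecidableEq Γ₀]
variable {K : Type} [Field K] [NumberField K] [IsCMField K] [IsGalois ℚ K]

/-- **`Γ₀ × C₂` from index-two data of `Γ₀`.**  `e : Gal(K/ℚ) ≃* Γ₀ × C₂`, `i₀ : A₀ ↪ Γ₀` abelian of index two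
(`Γ₀ = i₀(A₀) ⊔ i₀(A₀)x₀`), `x₀ i₀(a) = i₀(θ₀ a) x₀`, `x₀² = i₀(q₀)` (any `q₀`), complex conjugation `(i₀ c, 1)`; if `|A₀| > 4` and some
`u ≠ 1` has `c ∉ ⟨u⟩` then `K` carries a SIMPLE DEGENERATE abelian variety of dimension `|Γ₀|` with CM by `K` (rational `(p,p)`
class outside the divisor ring on some power). [cite: Kubota1965, §2 and §4 Lemma 2]
[cite: Shimura1998, §6.2 Thm. 3 and §8.2 Prop. 26] [cite: Gordon1999HodgeAVSurvey, Thm. 6.4 and §9.3] -/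
theorem exists_simple_degenerate_prod_two {A₀ : Type*} [CommGroup A₀] [Fintype A₀] [DecidableEq A₀]
    (e : (K ≃ₐ[ℚ] K) ≃* Γ₀ × Multiplicative (ZMod 2)) (i₀ : A₀ →* Γ₀) (hi₀ : Function.Injective i₀) (x₀ : Γ₀)
    (hx₀ : ∀ a, i₀ a ≠ x₀) (hcov₀ : ∀ g : Γ₀, (∃ a, g = i₀ a) ∨ (∃ a, g = i₀ a * x₀)) (θ₀ : A₀ ≃* A₀)
    (hθ₀ : ∀ a, x₀ * i₀ a = i₀ (θ₀ a) * x₀) (q₀ : A₀) (hq₀ : x₀ * x₀ = i₀ q₀) (c : A₀)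
    (hc : e ((IsCMField.complexConj K).restrictScalars ℚ) = (i₀ c, 1)) (u : A₀) (hu : u ≠ 1)
    (hcu : c ∉ Subgroup.zpowers u) (hcard : 4 < Fintype.card A₀) :
    ∃ (Φ : CMType K) (φ₀ : K →+* ℂ) (X : AbelianVariety ℂ) (ι : 𝓞 K →+* End X)
      (ϑ : K →+* Module.End ℂ (complexBetti X.X 1)),
      IsPrimitive (ℂ ≃+* ℂ) Φ.1 φ₀ ∧ ¬ IsNondegenerate Φ ∧ IsCMTypeRealisation Φ X ι ϑ ∧ X.IsSimple ∧
      X.dim = Fintype.card Γ₀ ∧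
      ∃ n p : ℕ, ∃ y : complexBetti (⨁ fun _ : Fin n => X).X (2 * p), IsRationalClass y ∧
        IsOfHodgeType (⨁ fun _ : Fin n => X).dim (⨁ fun _ : Fin n => X).X (2 * p) p p y ∧
        y ∉ divisorClassesSpan (⨁ fun _ : Fin n => X).X (⨁ fun _ : Fin n => X).dim p := by
  classical
  let i : A₀ × Multiplicative (ZMod 2) →* Γ₀ × Multiplicative (ZMod 2) := MonoidHom.prodMap i₀ (MonoidHom.id _)
  have hi_apply : ∀ a v, i (a, v) = (i₀ a, v) := fun a v => rfl
  have hi : Function.Injective i := by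
    rintro ⟨a, v⟩ ⟨a', v'⟩ h
    rw [hi_apply, hi_apply, Prod.mk.injEq] at h
    exact Prod.ext (hi₀ h.1) h.2
  have hx : ∀ w, i w ≠ (x₀, 1) := fun ⟨a, v⟩ h => hx₀ a (by rw [hi_apply, Prod.mk.injEq] at h; exact h.1)
  have hcov : ∀ g : Γ₀ × Multiplicative (ZMod 2), (∃ w, g = i w) ∨ (∃ w, g = i w * (x₀, 1)) := by
    rintro ⟨g, v⟩
    rcases hcov₀ g with ⟨a, rfl⟩ | ⟨a, rfl⟩
    · exact Or.inl ⟨(a, v), rfl⟩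
    · exact Or.inr ⟨(a, v), by rw [hi_apply, Prod.mk_mul_mk, mul_one]⟩
  have hθ : ∀ (a : A₀) (v : Multiplicative (ZMod 2)), (x₀, 1) * i (a, v) = i (θ₀ a, v) * (x₀, 1) := fun a v => by
    rw [hi_apply, hi_apply, Prod.mk_mul_mk, Prod.mk_mul_mk, one_mul, mul_one, hθ₀]
  have hq : (x₀, (1 : Multiplicative (ZMod 2))) * (x₀, 1) = i (q₀, 1) := by
    rw [hi_apply, Prod.mk_mul_mk, mul_one, hq₀]
  obtain ⟨Φ, φ₀, X, ι, ϑ, h1, h2, h3, h4, h5, h6⟩ := exists_simple_degenerate_of_index_two_times_two e i hi (x₀, 1) hx hcov θ₀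
    hθ (q₀, 1) hq c (by rw [hi_apply]; exact hc) u hu hcu hcard
  refine ⟨Φ, φ₀, X, ι, ϑ, h1, h2, h3, h4, ?_, h6⟩
  rw [h5, Fintype.card_prod, Fintype.card_multiplicative, ZMod.card, Nat.mul_div_cancel _ Nat.two_pos]

/-- **`Γ₀ × C_n` (`n ≥ 3`) from index-two data of `Γ₀` on the EASY side.**  `e : Gal(K/ℚ) ≃* Γ₀ × C_n`, `i₀ : B ↪ Γ₀`
(multiplicative notation for the additive group `B`) abelian of index two, `x₀ i₀(b) = i₀(θ₀ b) x₀` with `θ₀ ≠ id`, `x₀² = i₀(q₀)`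
with `c ∉ ⟨q₀⟩`, complex conjugation `(i₀ c, 1)` ⟹ a SIMPLE DEGENERATE abelian variety of dimension `n|Γ₀|/2` with CM by `K`.
[cite: Kubota1965, §2 and §4 Lemma 2] [cite: Shimura1998, §6.2 Thm. 3 and §8.2 Prop. 26]
[cite: Gordon1999HodgeAVSurvey, Thm. 6.4 and §9.3] -/
theorem exists_simple_degenerate_prod_cyclic {B : Type*} [AddCommGroup B] [Fintype B] [DecidableEq B] {n : ℕ} [NeZero n]
    (hn : 3 ≤ n) (e : (K ≃ₐ[ℚ] K) ≃* Γ₀ × Multiplicative (ZMod n)) (i₀ : Multiplicative B →* Γ₀)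
    (hi₀ : Function.Injective i₀) (x₀ : Γ₀) (hx₀ : ∀ a, i₀ a ≠ x₀)
    (hcov₀ : ∀ g : Γ₀, (∃ a, g = i₀ a) ∨ (∃ a, g = i₀ a * x₀)) (θ₀ : B ≃+ B)
    (hθ₀ : ∀ b, x₀ * i₀ (Multiplicative.ofAdd b) = i₀ (Multiplicative.ofAdd (θ₀ b)) * x₀) (hθ1 : ∃ b, θ₀ b ≠ b)
    (q₀ : Multiplicative B) (hq₀ : x₀ * x₀ = i₀ q₀) (c : B) (hcq : Multiplicative.ofAdd c ∉ Subgroup.zpowers q₀)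
    (hc : e ((IsCMField.complexConj K).restrictScalars ℚ) = (i₀ (Multiplicative.ofAdd c), 1)) :
    ∃ (Φ : CMType K) (φ₀ : K →+* ℂ) (X : AbelianVariety ℂ) (ι : 𝓞 K →+* End X)
      (ϑ : K →+* Module.End ℂ (complexBetti X.X 1)),
      IsPrimitive (ℂ ≃+* ℂ) Φ.1 φ₀ ∧ ¬ IsNondegenerate Φ ∧ IsCMTypeRealisation Φ X ι ϑ ∧ X.IsSimple ∧
      X.dim = Fintype.card Γ₀ * n / 2 ∧
      ∃ m p : ℕ, ∃ y : complexBetti (⨁ fun _ : Fin m => X).X (2 * p), IsRationalClass y ∧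
        IsOfHodgeType (⨁ fun _ : Fin m => X).dim (⨁ fun _ : Fin m => X).X (2 * p) p p y ∧
        y ∉ divisorClassesSpan (⨁ fun _ : Fin m => X).X (⨁ fun _ : Fin m => X).dim p := by
  classical
  let i : Multiplicative B × Multiplicative (ZMod n) →* Γ₀ × Multiplicative (ZMod n) := MonoidHom.prodMap i₀ (MonoidHom.id _)
  have hi_apply : ∀ a v, i (a, v) = (i₀ a, v) := fun a v => rfl
  have hi : Function.Injective i := by
    rintro ⟨a, v⟩ ⟨a', v'⟩ h
    rw [hi_apply, hi_apply, Prod.mk.injEq] at h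
    exact Prod.ext (hi₀ h.1) h.2
  have hx : ∀ w, i w ≠ (x₀, 1) := fun ⟨a, v⟩ h => hx₀ a (by rw [hi_apply, Prod.mk.injEq] at h; exact h.1)
  have hcov : ∀ g : Γ₀ × Multiplicative (ZMod n), (∃ w, g = i w) ∨ (∃ w, g = i w * (x₀, 1)) := by
    rintro ⟨g, v⟩
    rcases hcov₀ g with ⟨a, rfl⟩ | ⟨a, rfl⟩
    · exact Or.inl ⟨(a, v), rfl⟩
    · exact Or.inr ⟨(a, v), by rw [hi_apply, Prod.mk_mul_mk, mul_one]⟩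
  have hθ : ∀ (b : B) (v : Multiplicative (ZMod n)),
      (x₀, 1) * i (Multiplicative.ofAdd b, v) = i (Multiplicative.ofAdd (θ₀ b), v) * (x₀, 1) := fun b v => by
    rw [hi_apply, hi_apply, Prod.mk_mul_mk, Prod.mk_mul_mk, one_mul, mul_one, hθ₀]
  have hq : (x₀, (1 : Multiplicative (ZMod n))) * (x₀, 1) = i (q₀, 1) := by
    rw [hi_apply, Prod.mk_mul_mk, mul_one, hq₀]
  have hcq' : (Multiplicative.ofAdd c, (1 : Multiplicative (ZMod n))) ∉ Subgroup.zpowers (q₀, (1 : Multiplicative (ZMod n))) := by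
    rw [Subgroup.mem_zpowers_iff]
    rintro ⟨k, hk⟩
    rw [Prod.pow_mk, Prod.mk.injEq] at hk
    exact hcq (Subgroup.mem_zpowers_iff.2 ⟨k, hk.1⟩)
  obtain ⟨Φ, φ₀, X, ι, ϑ, h1, h2, h3, h4, h5, h6⟩ := exists_simple_degenerate_of_index_two_times_cyclic hn e i hi (x₀, 1) hx
    hcov θ₀ hθ hθ1 (q₀, 1) hq c hcq' (by rw [hi_apply]; exact hc)
  refine ⟨Φ, φ₀, X, ι, ϑ, h1, h2, h3, h4, ?_, h6⟩
  rw [h5, Fintype.card_prod, Fintype.card_multiplicative, ZMod.card]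

end Product

/-! ## §2 `(C_p ⋊ C₈) × C₂` -/

section CyclicSemidirectEight

variable {p : ℕ} [Fact p.Prime]
variable {K : Type} [Field K] [NumberField K] [IsCMField K] [IsGalois ℚ K]

/-- **`(C_p ⋊ C₈) × C₂` is BAD for every prime `p`** (`φ(1)` = inversion on `C_p`, complex conjugation `(y⁴, 1)`; no parity
hypothesis is needed): `K` carries
a SIMPLE DEGENERATE abelian variety of dimension `8p` with CM by `K` — `A₀ = ⟨y²⟩ × C_p ≅ ℤ/4 × ℤ/p` (`|A₀| = 4p > 4`),
`u = (0, 1) ∈ C_p`, `c = (2, 0) ∉ ⟨u⟩`; the `× C₂` theorem, hard side (`x₀² = y² = i₀(1, 0) ∋ c`).  Compare: `C_p ⋊ C₈` ALONE is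
GOOD for `p ≡ 5 (mod 8)`. [cite: Kubota1965, §2 and §4 Lemma 2] [cite: Shimura1998, §6.2 Thm. 3 and §8.2 Prop. 26]
[cite: Gordon1999HodgeAVSurvey, Thm. 6.4 and §9.3] -/
theorem exists_simple_degenerate_cyclicSemidirectEight_times_two
    (φ : Multiplicative (ZMod 8) →* MulAut (Multiplicative (ZMod p)))
    (hφ : ∀ v : Multiplicative (ZMod p), φ (Multiplicative.ofAdd 1) v = v⁻¹)
    (e : (K ≃ₐ[ℚ] K) ≃* (Multiplicative (ZMod p) ⋊[φ] Multiplicative (ZMod 8)) × Multiplicative (ZMod 2))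
    (hc : e ((IsCMField.complexConj K).restrictScalars ℚ) = (SemidirectProduct.inr (Multiplicative.ofAdd 4), 1)) :
    ∃ (Φ : CMType K) (φ₀ : K →+* ℂ) (X : AbelianVariety ℂ) (ι : 𝓞 K →+* End X)
      (ϑ : K →+* Module.End ℂ (complexBetti X.X 1)),
      IsPrimitive (ℂ ≃+* ℂ) Φ.1 φ₀ ∧ ¬ IsNondegenerate Φ ∧ IsCMTypeRealisation Φ X ι ϑ ∧ X.IsSimple ∧ X.dim = 8 * p ∧
      ∃ n q : ℕ, ∃ y : complexBetti (⨁ fun _ : Fin n => X).X (2 * q), IsRationalClass y ∧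
        IsOfHodgeType (⨁ fun _ : Fin n => X).dim (⨁ fun _ : Fin n => X).X (2 * q) q q y ∧
        y ∉ divisorClassesSpan (⨁ fun _ : Fin n => X).X (⨁ fun _ : Fin n => X).dim q := by
  classical
  have hp : p.Prime := Fact.out
  haveI : NeZero p := ⟨hp.ne_zero⟩
  haveI : Fintype (Multiplicative (ZMod p) ⋊[φ] Multiplicative (ZMod 8)) :=
    Fintype.ofEquiv _ SemidirectProduct.equivProd.symm
  -- the index-two data of `C_p ⋊ C₈` (gen 28 `CorCM/GaloisCyclicSemidirectEightDegenerate`): `A₀ = ⟨y²⟩ × C_p`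
  have h24 : Multiplicative.ofAdd (2 : ZMod 8) ^ 4 = 1 := by
    rw [← ofAdd_nsmul]; decide
  let f : Multiplicative (ZMod 4) × Multiplicative (ZMod p) → Multiplicative (ZMod p) ⋊[φ] Multiplicative (ZMod 8) :=
    fun w => ⟨w.2, Multiplicative.ofAdd (2 : ZMod 8) ^ (Multiplicative.toAdd w.1).val⟩
  have hf_apply : ∀ w, f w = ⟨w.2, Multiplicative.ofAdd (2 : ZMod 8) ^ (Multiplicative.toAdd w.1).val⟩ :=
    fun w => rfl
  let i : Multiplicative (ZMod 4) × Multiplicative (ZMod p) →* Multiplicative (ZMod p) ⋊[φ] Multiplicative (ZMod 8) :=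
    MonoidHom.mk' f fun w w' => by
      refine SemidirectProduct.ext ?_ ?_
      · simp only [hf_apply, SemidirectProduct.mul_left, Prod.snd_mul, GaloisCyclicSemidirectEight.phi_two_pow φ hφ]
      · simp only [hf_apply, SemidirectProduct.mul_right, Prod.fst_mul, toAdd_mul, ← pow_add]
        rw [ZMod.val_add, ← pow_eq_pow_mod _ h24]
  have hi_apply : ∀ w, i w = ⟨w.2, Multiplicative.ofAdd (2 : ZMod 8) ^ (Multiplicative.toAdd w.1).val⟩ :=
    fun w => rfl
  have hval4 : ∀ t : Multiplicative (ZMod 4), (Multiplicative.toAdd t).val < 4 := fun t => ZMod.val_lt _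
  have hpow2 : ∀ k : ℕ, Multiplicative.ofAdd (2 : ZMod 8) ^ k = Multiplicative.ofAdd ((2 * k : ℕ) : ZMod 8) :=
    fun k => by rw [← ofAdd_nsmul, nsmul_eq_mul, Nat.cast_mul, Nat.cast_ofNat, mul_comm]
  have hinj2 : ∀ k k' : ℕ, k < 4 → k' < 4 →
      Multiplicative.ofAdd (2 : ZMod 8) ^ k = Multiplicative.ofAdd (2 : ZMod 8) ^ k' → k = k' := by
    intro k k' hk hk' h
    rw [hpow2, hpow2, Equiv.apply_eq_iff_eq, ZMod.natCast_eq_natCast_iff'] at h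
    omega
  have hne1 : ∀ k : ℕ, Multiplicative.ofAdd (2 : ZMod 8) ^ k ≠ Multiplicative.ofAdd 1 := by
    intro k h
    rw [hpow2, Equiv.apply_eq_iff_eq, show (1 : ZMod 8) = ((1 : ℕ) : ZMod 8) by norm_num,
      ZMod.natCast_eq_natCast_iff'] at h
    omega
  have hi : Function.Injective i := by
    rintro ⟨t, v⟩ ⟨t', v'⟩ h
    rw [hi_apply, hi_apply, SemidirectProduct.ext_iff] at h
    refine Prod.ext ?_ h.1
    have := hinj2 _ _ (hval4 t) (hval4 t') h.2
    exact Multiplicative.toAdd.injective (ZMod.val_injective _ this)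
  set y : Multiplicative (ZMod p) ⋊[φ] Multiplicative (ZMod 8) :=
    SemidirectProduct.inr (Multiplicative.ofAdd (1 : ZMod 8)) with hy_def
  have hy : y = ⟨1, Multiplicative.ofAdd 1⟩ := rfl
  have hx : ∀ w, i w ≠ y := fun ⟨t, v⟩ h => by
    rw [hi_apply, hy, SemidirectProduct.ext_iff] at h
    exact hne1 _ h.2
  have hcov : ∀ g : Multiplicative (ZMod p) ⋊[φ] Multiplicative (ZMod 8), (∃ w, g = i w) ∨ (∃ w, g = i w * y) := by
    rintro ⟨v, m⟩
    set n : ℕ := (Multiplicative.toAdd m).val with hn_def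
    have hn8 : n < 8 := ZMod.val_lt _
    have hk4 : ((n / 2 : ℕ) : ZMod 4).val = n / 2 := ZMod.val_natCast_of_lt (by omega)
    have hm : m = Multiplicative.ofAdd (2 : ZMod 8) ^ (n / 2) * Multiplicative.ofAdd (1 : ZMod 8) ^ (n % 2) := by
      rw [← ofAdd_nsmul, ← ofAdd_nsmul, ← ofAdd_add, nsmul_eq_mul, nsmul_eq_mul]
      conv_lhs => rw [← ofAdd_toAdd m, ← ZMod.natCast_zmod_val (Multiplicative.toAdd m)]
      rw [← hn_def, ← Nat.div_add_mod n 2]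
      congr 1
      have e1 : (2 * (n / 2) + n % 2) / 2 = n / 2 := by omega
      have e2 : (2 * (n / 2) + n % 2) % 2 = n % 2 := by omega
      rw [e1, e2]
      push_cast
      ring
    rcases Nat.mod_two_eq_zero_or_one n with h0 | h1
    · refine Or.inl ⟨(Multiplicative.ofAdd ((n / 2 : ℕ) : ZMod 4), v), ?_⟩
      rw [hi_apply, toAdd_ofAdd, hk4, hm, h0, pow_zero, mul_one]
    · refine Or.inr ⟨(Multiplicative.ofAdd ((n / 2 : ℕ) : ZMod 4), v), ?_⟩
      rw [hi_apply, toAdd_ofAdd, hk4, hy, SemidirectProduct.mul_def]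
      refine SemidirectProduct.ext ?_ ?_
      · simp
      · simpa [h1] using hm
  let θ : Multiplicative (ZMod 4) × Multiplicative (ZMod p) ≃* Multiplicative (ZMod 4) × Multiplicative (ZMod p) :=
    MulEquiv.prodCongr (MulEquiv.refl _) (MulEquiv.inv _)
  have hθ_apply : ∀ w, θ w = (w.1, w.2⁻¹) := fun w => rfl
  have hθ : ∀ w, y * i w = i (θ w) * y := fun ⟨t, v⟩ => by
    rw [hi_apply, hi_apply, hθ_apply, hy, SemidirectProduct.mul_def, SemidirectProduct.mul_def]
    refine SemidirectProduct.ext ?_ ?_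
    · simp [hφ]
    · simp [mul_comm]
  set q : Multiplicative (ZMod 4) × Multiplicative (ZMod p) := (Multiplicative.ofAdd 1, 1) with hq_def
  have h1val : (1 : ZMod 4).val = 1 := by decide
  have hyy : y * y = i q := by
    rw [hi_apply, hq_def, toAdd_ofAdd, h1val, pow_one, hy, SemidirectProduct.mul_def]
    refine SemidirectProduct.ext ?_ ?_
    · simp
    · change Multiplicative.ofAdd (1 : ZMod 8) * Multiplicative.ofAdd 1 = Multiplicative.ofAdd 2
      rw [← ofAdd_add]; norm_num
  set c : Multiplicative (ZMod 4) × Multiplicative (ZMod p) := (Multiplicative.ofAdd 2, 1) with hc_def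
  have h2val : (2 : ZMod 4).val = 2 := by decide
  have hic : i c = SemidirectProduct.inr (Multiplicative.ofAdd (4 : ZMod 8)) := by
    rw [hi_apply, hc_def, toAdd_ofAdd, h2val, hpow2]
    rfl
  -- `u = (0, 1) ∈ C_p`: order `p`, and `c = (2, 0) ∉ ⟨u⟩`
  set u : Multiplicative (ZMod 4) × Multiplicative (ZMod p) := (1, Multiplicative.ofAdd 1) with hu_def
  haveI : Fact (1 < p) := ⟨hp.one_lt⟩
  have h1p : (1 : ZMod p) ≠ 0 := one_ne_zero
  have hu : u ≠ 1 := by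
    rw [hu_def, Ne, Prod.mk_eq_one, not_and_or]
    exact Or.inr (fun h => h1p (by simpa using congrArg Multiplicative.toAdd h))
  have hcu : c ∉ Subgroup.zpowers u := by
    rw [Subgroup.mem_zpowers_iff]
    rintro ⟨k, hk⟩
    rw [hu_def, hc_def, Prod.pow_mk, one_zpow, Prod.mk.injEq] at hk
    exact absurd (congrArg Multiplicative.toAdd hk.1) (by decide)
  have hcard : 4 < Fintype.card (Multiplicative (ZMod 4) × Multiplicative (ZMod p)) := by
    rw [Fintype.card_prod, Fintype.card_multiplicative, Fintype.card_multiplicative, ZMod.card, ZMod.card]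
    have := hp.two_le; omega
  obtain ⟨Φ, φ₀, X, ι, ϑ, h1, h2, h3, h4, h5, h6⟩ := exists_simple_degenerate_prod_two e i hi y hx hcov θ hθ q hyy c
    (by rw [hic]; exact hc) u hu hcu hcard
  refine ⟨Φ, φ₀, X, ι, ϑ, h1, h2, h3, h4, ?_, h6⟩
  rw [h5, GaloisCyclicSemidirectEight.card_eq]

end CyclicSemidirectEight

end Summit.HodgeConjecture.CorCM.SplitInvolution

end
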